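import Mathlib
import HarnessLib
import Literature.NumberTheory.DiophantineGeometry.FunctionFieldGenus

/-!
# Greatest common divisors of `1 - a`, `1 - b` for `S`-units over function fields
# (Corvaja–Zannier 2008, §2, Corollary 2.3)

Trunk `Literature/NumberTheory/DiophantineGeometry` (function fields of one variable over the
tree's interface `IsAlgFunctionField`, `AlgFunctionField.PlaceOver`, `PlaceOver.ord`,
`PlaceOver.degree`, `AlgFunctionField.genus` of `FunctionFieldDivisors.lean` /
`FunctionFieldGenus.lean`; sibling of `MasonFundamentalInequality.lean`, same conventions).

P. Corvaja, U. Zannier, *Some cases of Vojta's conjecture on integral points over function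
fields*, J. Algebraic Geom. 17 (2008), no. 2, 295–333 = arXiv:math/0512074 [CorvajaZannier2007],
§2 "Greatest common divisors over function fields". Standing hypotheses of §2 (p. 3 of the arXiv
text): "Let `κ` be, as before, an algebraically closed field of characteristic zero, `𝒞` a smooth
complete curve defined over `κ`, of genus `g = g(𝒞)`, `S ⊂ 𝒞` a finite nonempty set of points of
`𝒞`. … `O_S^*` [is] the group of `S`-units, i.e. of rational functions on `𝒞` with all their zeros
and poles in `S`. As usual, for a rational function `a ∈ κ(𝒞)`, we let `H(a) = H_𝒞(a)` be its
height, i.e. its degree as a morphism `a : 𝒞 → ℙ¹`. … the Euler characteristic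
`χ = χ(𝒞 ∖ S) = #(S) + 2g(𝒞) − 2` will often appear. We also note that if a nonconstant `S`-unit
exists, as in our context, then necessarily `#(S) ≥ 2`, so `χ ≥ 0`." Multiplicative dependence
(p. 4): "some nontrivial relation `a^r = λ b^s` for integers `r, s` not both zero and a `λ ∈ κ^*`".

**Corollary 2.3.** "Let `a, b ∈ O_S^*` be `S`-units, not both constant, and let
`H := max{H(a), H(b)}`. (i) If `a, b` are multiplicatively independent, we have
`Σ_{v ∉ S} min{v(1−a), v(1−b)} ≤ 3·∛2·(H(a)H(b)χ)^{1/3} ≤ 3·∛2·(H²χ)^{1/3}`.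
(ii) If `a, b` are multiplicatively dependent, let `a^r = λ b^s` be a generating relation. Then
either `λ ≠ 1` and `Σ_{v∉S} min{v(1−a), v(1−b)} = 0`, or `λ = 1` and
`Σ_{v∉S} min{v(1−a), v(1−b)} ≤ min{H(a)/|s|, H(b)/|r|} ≤ H/max{|r|,|s|}`."
(p. 4: "The constant `3∛2` in part (i) cannot be replaced by anything smaller than `(4/3)^{1/3}`,
as shown by the example `a = t³`, `b = −t(t+1)`." It is the function-field analogue of
Corvaja–Zannier's arithmetic gcd bound for `S`-units in number fields, Prop. 2 of their Monatsh.
Math. 2005 paper, itself a consequence of the Subspace Theorem.)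

Vendored here AS PRINTED, part (i) (the quantitative gcd bound), as a NAMED FACT (`def … : Prop`,
review-queued, no proof). Rendering over the tree's interface: constant field `k` algebraically
closed of characteristic zero, `F/k` an algebraic function field of one variable (`= κ(𝒞)`), places
`PlaceOver k F` (`=` points of `𝒞`; all of degree `1` since `k` is algebraically closed, so the
degree weights written below — the same spelling as `Mason1984_lemma2` and as the heights of the
ABC route items — change nothing), `S : Finset (PlaceOver k F)` nonempty, `S`-units = non-zero
`a` with `ord_v a = 0` off `S`, `H(a) = Σ_v deg v · max(0, −ord_v a)` (number of poles with
multiplicity = degree of `a`), `χ = #S + 2·genus − 2`, "constant" = in the image of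
`algebraMap k F`, multiplicative independence modulo constants = no relation `a^r = λ b^s`,
`(r,s) ≠ (0,0)`, `λ ∈ k^×` (written with integer powers in the field `F`). The left side is the
finitely supported sum over places OFF `S` of `deg v · min(ord_v(1−a), ord_v(1−b))` (each term
`≥ 0` off `S`, and `1 − a, 1 − b ≠ 0` by independence); the right side is the real number
`3 · (2 · H(a) · H(b) · χ)^{1/3}` (`Real.rpow`; `χ ≥ 0` under the hypotheses, as quoted, so no
negative base occurs).

Relevance: this is the function-field "gcd law" named in the kill criteria of the ABC route
`Summits/ABC/ABC/Theses/GvfSupportTransfer.lean` (items `LinearLawTransfer`,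
`GenusNegligibleDensity`: "Corvaja–Zannier gcd shapes"); note it is NOT linear in the heights
(`H^{2/3}χ^{1/3}`), hence invisible at the linear scale of those items, exactly as the refuters
recorded. No Mathlib or tree declaration states a gcd bound for `S`-units (searched `gcd.*unit`,
`Corvaja`, `multiplicatively`); the arithmetic analogue for `gcd(aⁿ−1, bⁿ−1)` is
[BugeaudCorvajaZannier2003] (cited in `references.bib`, not formalised).
-/

namespace Literature.NumberTheory.DiophantineGeometry

open AlgFunctionField

open scoped Classical in
/-- **Corvaja–Zannier 2008, Corollary 2.3 (i)** (J. Algebraic Geom. 17 (2008) 295–333 =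
arXiv:math/0512074, §2). Let `k` be algebraically closed of characteristic zero, `F/k` an
algebraic function field of one variable of genus `g`, `S` a finite nonempty set of places,
`a, b` `S`-units (all zeros and poles in `S`), not both constant and multiplicatively independent
modulo constants (no relation `a^r = λ b^s` with `(r,s) ≠ (0,0)`, `λ ∈ k^×`). Then
`Σ_{v ∉ S} min{ord_v(1−a), ord_v(1−b)} ≤ 3·∛2·(H(a)·H(b)·χ)^{1/3}`, where
`H(f) = Σ_v max(0, −ord_v f)` is the number of poles counted with multiplicity and
`χ = #S + 2g − 2` (`≥ 0` here). Written with place degrees (all `1` over an algebraically closed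
constant field) as in `Mason1984_lemma2`. The printed constant is sharp up to a factor
(`≥ (4/3)^{1/3}` is needed: `a = t³`, `b = −t(t+1)`). The function-field gcd law referred to by
`Summit.ABC.ABC.Theses.GvfSupportTransfer.LinearLawTransfer` / `.GenusNegligibleDensity`
(sub-linear in the heights). A named fact: users take `(h : CorvajaZannier2008_cor23)`.
[cite: CorvajaZannier2007, Cor 2.3 (i)] -/
def CorvajaZannier2008_cor23 : Prop :=
  ∀ (k : Type) [Field k] [IsAlgClosed k] [CharZero k] (F : Type) [Field F] [Algebra k F]
    [IsAlgFunctionField k F] (S : Finset (PlaceOver k F)) (a b : F),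
    S.Nonempty → a ≠ 0 → b ≠ 0 →
    (∀ v : PlaceOver k F, v ∉ S → v.ord a = 0 ∧ v.ord b = 0) →
    (a ∉ Set.range (algebraMap k F) ∨ b ∉ Set.range (algebraMap k F)) →
    (∀ (r s : ℤ) (c : k), (r, s) ≠ (0, 0) → c ≠ 0 → a ^ r ≠ algebraMap k F c * b ^ s) →
    ((∑ᶠ v : PlaceOver k F,
        if v ∈ S then (0 : ℤ) else (v.degree : ℤ) * min (v.ord (1 - a)) (v.ord (1 - b)) : ℤ) : ℝ) ≤
      3 * (2 * (∑ᶠ v : PlaceOver k F, ((v.degree : ℤ) * max 0 (-(v.ord a)) : ℤ) : ℝ) *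
            (∑ᶠ v : PlaceOver k F, ((v.degree : ℤ) * max 0 (-(v.ord b)) : ℤ) : ℝ) *
            ((S.card : ℝ) + (2 * (genus k F : ℝ) - 2))) ^ ((1 : ℝ) / 3)

end Literature.NumberTheory.DiophantineGeometry
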